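import Summits.QuantumFields.YangMills.Theorems.BalabanUVNodesPortU8CurrentLinearisation
import Summits.QuantumFields.YangMills.Theorems.BalabanUVNodesPortU8IotaC2Transport

/-!
# PORT PT-B (U8), g2 file 4 — CHART-GENERIC TRANSPORT: every row PT-B's closer reads of a two-block chart `ι_bg(B) = (sl2Coord (log bg(B)(b)), sl2Coord (J(bg(B))(b)))_b`
# over ANY `SU(2)`-valued background-field map `bg` with `bg 0 = 1` — value at `0`, `C²` bridge, the `log 𝐔`-block and the `𝐉`-block of `Dι(0)`, the chart matrices of
# the CUT response, and the `𝐉`-clause bound from (190)'s fourth line — so that the rooted chart `recordEmbJ` (`bg := recordBgField`) and RC-2's Landau chart `recordEmbL`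
# (`bg := recordBgFieldL`, DEF-1 ed.14, CRIT-1 Q-12∕Q-12b) are INSTANCES by `rfl` on the shape — `--supports stmt-QuantumFields-27931` (helper; NOT a closer)

Cell `ym-nodeO-ideate` ∕ `ym-balaban-port`, porter `ymgap-nodeO-port-PTB-1` (gen 2), item **stmt-QuantumFields-27931** `BalabanUVNodes.PortPieceLocalityU8`.
[I] = [Balaban1987RG1], [15] = [Balaban1985Variational].
WHY.  Q-12 (UPHELD 01:11:41Z): the signed (C1) charts the rooted-gauge minimiser; ⁷‴ re-keys the consequent (and the two ∂_B tokens, Q-12b X1′) to the L-chart of a definite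
Landau object `recordBgFieldL`.  The transport lemmas of g0 files 5–8 and g2 file 2 §3–§4 were stated for `recordEmbJ` BY NAME; here they are re-issued ONCE over an
arbitrary `bg : E → GaugeField (F.P K) 0 (SU 2)` (any real normed parameter space `E`, base point `0`) and an arbitrary coordinate map `ι : E → (Fin (recordChartDimJ F K) → ℂ)` tied
to `bg` only through the displayed SHAPE hypothesis `hι` — so the ⁷‴ closer instantiates them with `bg := recordBgFieldL B`, `ι := recordEmbL`, and nothing is re-proved.
WHAT IS PROVED (0 `sorry`, 0 `def`; standard axioms): §1 `iota_zero_of_shape` (`bg 0 = 1 ⇒ ι 0 = 0`); §2 `contDiffAt_iota_of_shape` (`bg` `Cⁿ` at `0` in `M₂(ℂ)` ⇒ `ι` `Cⁿ`), with the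
entrywise∕analytic bridges; §3 ★ `fderiv_iota_inl_eq_of_shape` (`Dι(0)δ (b,𝐔,c) = sl2Coord (U′δ b) c`), ★ `fderiv_iota_inr_eq_of_shape` (`Dι(0)δ (b,𝐉,c) = sl2Coord (−iξ⁻³π(d*dU′δ)(b)) c`
— port M); §4 ★★ `chartMatU_cutTo_fderiv_iota` ∕ ★★ `chartMatJc_cutTo_fderiv_iota` (chart matrices of the CUT response `cutTo (recordCXJ X) (Dι(0)δ)`: `U′δ b` ∕ the linearised
current on `b ∈ X`, `0` off `X`) and their ENTRY-currency forms (`U′δ b = Matrix.of (D b)`, `D := fderiv` of the entry map); §5 ★★ `norm_chartMatJc_cutTo_fderiv_iota_le` (the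
`𝐉`-block bounded by `2‖π_ℝ‖ξ⁻³·t` from `‖(d*dD)(b)‖ ≤ t` — (190) line 4 read on `D` itself, the ⁷‴ token shape).
HONEST FRAMING.  Lattice calculus + bookkeeping over an ABSTRACT chart; nothing of Bałaban asserted; 27931 OPEN (CLOSE HOLD, Q-12); K0⁷ NOT closed; NODE O 0∕1; COUNT 8∕28 · K 1∕4
UNMOVED; finite `𝕋⁴_{L^K}` at fixed ε — NOT continuum ∕ OS ∕ Clay; **the Yang–Mills mass gap (Clay) is NOT proved.**
-/

noncomputable section

open scoped BigOperators Matrix.Norms.L2Operator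
open Complex (I)

namespace Summit.QuantumFields.YangMills.Theorems.PortU8

open Literature.MathematicalPhysics.QuantumFieldTheory.Balaban1983to89
open Literature.MathematicalPhysics.QuantumFieldTheory.Balaban1983to89.Node00
open Literature.MathematicalPhysics.QuantumFieldTheory.Balaban1983to89.T4Continuum (T4Family)
open Literature.MathematicalPhysics.QuantumFieldTheory.Balaban1983to89.B12Eq18Current (current)
open Summit.QuantumFields.YangMills.Theorems.K0RecordFormatNames
open Summit.QuantumFields.YangMills.Theorems.BalabanUVNodesPortS1 (trace_sl2Proj)

section Shape

variable (F : T4Family) {E : Type*} [NormedAddCommGroup E] [NormedSpace ℝ E] (k K : ℕ)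
  (bg : E → GaugeField (F.P K) 0 (SU 2)) (ι : E → Fin (recordChartDimJ F K) → ℂ)

/-! ## §1  The chart vanishes at the flat centre -/

omit [NormedSpace ℝ E] in
/-- **`ι(0) = 0` for any chart of the two-block SHAPE over a background map with `bg 0 = 1`** (`log 1 = 0`, `J(1) = 0`).
[cite: Balaban1987RG1, (1.8)–(1.9) p.261, (4.35) p.290] -/
theorem iota_zero_of_shape
    (hι : ∀ e i, ι e i = Sum.elim (fun a => sl2Coord (MatrixLog.mlog ((bg e ((chartEquivJ F K).symm i).1 : SU 2) : MatA 2)) a)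
      (fun a => sl2Coord (current sl2Proj ((F.P K).eta (k + 1)) (fun b => ιSU 2 (bg e b)) ((chartEquivJ F K).symm i).1) a) ((chartEquivJ F K).symm i).2)
    (h0 : bg 0 = 1) : ι 0 = 0 := by
  funext i
  rw [hι, h0]
  have hu : (fun b : PBond (F.P K) 0 => ιSU 2 ((1 : GaugeField (F.P K) 0 (SU 2)) b)) = 1 := by
    funext b; exact map_one _
  rw [hu, current_one]
  show Sum.elim (fun a => sl2Coord (MatrixLog.mlog ((1 : SU 2) : MatA 2)) a) (fun a => sl2Coord (0 : MatA 2) a) ((chartEquivJ F K).symm i).2 = 0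
  have h1 : ((1 : SU 2) : MatA 2) = 1 := rfl
  rw [h1, MatrixLog.mlog_one, sl2Coord_zero]
  cases ((chartEquivJ F K).symm i).2 <;> rfl

/-! ## §2  The `C²` bridge -/

/-- The inverse of the units-read background field is the conjugate transpose. [cite: Balaban1987RG1, (1.10) p.262 (bookkeeping)] -/
theorem coe_ιSU_inv (g : SU 2) : (((ιSU 2 g)⁻¹ : (MatA 2)ˣ) : MatA 2) = star ((g : SU 2) : MatA 2) := by
  rw [← map_inv, coe_ιSU, ← Matrix.star_eq_inv, Matrix.specialUnitaryGroup.coe_star]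

/-- **`Cⁿ` TRANSPORT for any chart of the SHAPE**: if `e ↦ (bg e b)_b` is `Cⁿ` at `0` in `M₂(ℂ)` and `bg 0 = 1`, then `ι` is `Cⁿ` at `0` (`mlog` analytic at `1`; the current
is smooth in the bond variables and their inverses, file 5 §2). [cite: Balaban1987RG1, (4.35) p.290, (1.8)–(1.9) p.261; Balaban1985Variational, Prop. 9 p.309] -/
theorem contDiffAt_iota_of_shape {n : WithTop ℕ∞}
    (hι : ∀ e i, ι e i = Sum.elim (fun a => sl2Coord (MatrixLog.mlog ((bg e ((chartEquivJ F K).symm i).1 : SU 2) : MatA 2)) a)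
      (fun a => sl2Coord (current sl2Proj ((F.P K).eta (k + 1)) (fun b => ιSU 2 (bg e b)) ((chartEquivJ F K).symm i).1) a) ((chartEquivJ F K).symm i).2)
    (h0 : bg 0 = 1) (hU : ContDiffAt ℝ n (fun e => fun b : PBond (F.P K) 0 => ((bg e b : SU 2) : MatA 2)) 0) :
    ContDiffAt ℝ n ι 0 := by
  have hb : ∀ b, ContDiffAt ℝ n (fun e => ((bg e b : SU 2) : MatA 2)) 0 := fun b => contDiffAt_pi.1 hU b
  have hW : ∀ b, ContDiffAt ℝ n (fun e => ((ιSU 2 (bg e b) : (MatA 2)ˣ) : MatA 2)) 0 := hb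
  have hW' : ∀ b, ContDiffAt ℝ n (fun e => (((ιSU 2 (bg e b))⁻¹ : (MatA 2)ˣ) : MatA 2)) 0 := by
    intro b
    simp only [coe_ιSU_inv]
    exact contDiff_star'.contDiffAt.comp 0 (hb b)
  have hlog : ∀ b (a : Fin 3), ContDiffAt ℝ n (fun e => sl2Coord (MatrixLog.mlog ((bg e b : SU 2) : MatA 2)) a) 0 := by
    intro b a
    have h00 : ((bg 0 b : SU 2) : MatA 2) = 1 := by rw [h0]; rfl
    have hm : ContDiffAt ℝ n (MatrixLog.mlog : MatA 2 → MatA 2) ((bg 0 b : SU 2) : MatA 2) := by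
      rw [h00]
      exact ((MatrixLog.analyticAt_mlog (by simp)).contDiffAt).restrict_scalars ℝ
    exact ContDiffAt.comp (g := fun A : MatA 2 => sl2Coord A a) 0 (contDiff_sl2Coord a).contDiffAt
      (ContDiffAt.comp (g := (MatrixLog.mlog : MatA 2 → MatA 2)) (f := fun e => ((bg e b : SU 2) : MatA 2)) 0 hm (hb b))
  have hcur : ∀ b (a : Fin 3), ContDiffAt ℝ n (fun e => sl2Coord (current sl2Proj ((F.P K).eta (k + 1)) (fun b => ιSU 2 (bg e b)) b) a) 0 := by
    intro b a
    exact ContDiffAt.comp (g := fun A : MatA 2 => sl2Coord A a) 0 (contDiff_sl2Coord a).contDiffAt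
      (contDiffAt_current (W := fun e => fun b => ιSU 2 (bg e b)) hW hW' sl2Proj ((F.P K).eta (k + 1)) b)
  rw [contDiffAt_pi]
  intro i
  obtain ⟨⟨b, t⟩, rfl⟩ := (chartEquivJ F K).surjective i
  have hfun : (fun e => ι e (chartEquivJ F K (b, t))) = fun e => Sum.elim (fun a => sl2Coord (MatrixLog.mlog ((bg e b : SU 2) : MatA 2)) a)
      (fun a => sl2Coord (current sl2Proj ((F.P K).eta (k + 1)) (fun b => ιSU 2 (bg e b)) b) a) t := by
    funext e; rw [hι]; simp
  rw [hfun]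
  rcases t with a | a
  · simpa using hlog b a
  · simpa using hcur b a

/-- The same from the ENTRYWISE `Cⁿ` hypothesis (sup norms — the token currency). [cite: Balaban1985Variational, Prop. 9 p.309] -/
theorem contDiffAt_iota_of_shape_entries {n : WithTop ℕ∞}
    (hι : ∀ e i, ι e i = Sum.elim (fun a => sl2Coord (MatrixLog.mlog ((bg e ((chartEquivJ F K).symm i).1 : SU 2) : MatA 2)) a)
      (fun a => sl2Coord (current sl2Proj ((F.P K).eta (k + 1)) (fun b => ιSU 2 (bg e b)) ((chartEquivJ F K).symm i).1) a) ((chartEquivJ F K).symm i).2)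
    (h0 : bg 0 = 1) (hd : ContDiffAt ℝ n (fun e => fun (b : PBond (F.P K) 0) (i i' : Fin 2) => ((bg e b : SU 2) : MatA 2) i i') 0) :
    ContDiffAt ℝ n ι 0 :=
  contDiffAt_iota_of_shape F k K bg ι hι h0 (contDiffAt_matrix_of_entries hd)

/-! ## §3  The two blocks of `Dι(0)` -/

/-- ★ **`log 𝐔`-block of `Dι(0)`**: with `U′` the derivative of `e ↦ (bg e b)_b` at `0` (in `M₂(ℂ)`), `bg 0 = 1` and `ι` differentiable at `0`:
`Dι(0)δ (b, 𝐔, c) = sl2Coord (U′δ b) c` (`D log(1) = id`). [cite: Balaban1987RG1, (4.35) p.290, p.258; Balaban1985Variational, (182) p.307] -/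
theorem fderiv_iota_inl_eq_of_shape
    (hι : ∀ e i, ι e i = Sum.elim (fun a => sl2Coord (MatrixLog.mlog ((bg e ((chartEquivJ F K).symm i).1 : SU 2) : MatA 2)) a)
      (fun a => sl2Coord (current sl2Proj ((F.P K).eta (k + 1)) (fun b => ιSU 2 (bg e b)) ((chartEquivJ F K).symm i).1) a) ((chartEquivJ F K).symm i).2)
    (h0 : bg 0 = 1) (U' : E →L[ℝ] (PBond (F.P K) 0 → MatA 2))
    (hU : HasFDerivAt (fun e => fun b : PBond (F.P K) 0 => ((bg e b : SU 2) : MatA 2)) U' 0) (hE : DifferentiableAt ℝ ι 0)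
    (δ : E) (b : PBond (F.P K) 0) (c : Fin 3) :
    fderiv ℝ ι 0 δ (chartEquivJ F K (b, Sum.inl c)) = sl2Coord (U' δ b) c := by
  have hUb : HasFDerivAt (fun e => ((bg e b : SU 2) : MatA 2)) ((ContinuousLinearMap.proj b).comp U') 0 := (hasFDerivAt_pi'.1 hU) b
  have h00 : ((bg 0 b : SU 2) : MatA 2) = 1 := by rw [h0]; rfl
  have hm : HasFDerivAt (MatrixLog.mlog : MatA 2 → MatA 2) (ContinuousLinearMap.id ℝ (MatA 2)) ((bg 0 b : SU 2) : MatA 2) := by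
    rw [h00]; exact hasFDerivAt_mlog_one_real
  obtain ⟨Lc, hLc, hc⟩ := hasFDerivAt_sl2Coord c (MatrixLog.mlog ((bg 0 b : SU 2) : MatA 2))
  have hfun : (fun e => ι e (chartEquivJ F K (b, Sum.inl c))) = fun e => sl2Coord (MatrixLog.mlog ((bg e b : SU 2) : MatA 2)) c := by
    funext e; rw [hι]; simp
  have hcomp : HasFDerivAt (fun e => ι e (chartEquivJ F K (b, Sum.inl c))) ((ContinuousLinearMap.proj (chartEquivJ F K (b, Sum.inl c))).comp (fderiv ℝ ι 0)) 0 :=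
    (hasFDerivAt_pi'.1 hE.hasFDerivAt) _
  rw [hfun] at hcomp
  have h2 := hc.comp 0 (hm.comp 0 hUb)
  simp only [Function.comp_def] at h2
  have huniq := hcomp.unique h2
  show ((ContinuousLinearMap.proj (chartEquivJ F K (b, Sum.inl c))).comp (fderiv ℝ ι 0)) δ = _
  rw [huniq]
  exact hLc _

/-- ★ **`𝐉`-block of `Dι(0)` = the LINEARISED CURRENT of `U′δ`** (port M, `hasDerivAt_current_one`): under the same hypotheses,
`Dι(0)δ (b, 𝐉, c) = sl2Coord (−iξ⁻³ π (d*d(U′δ))(b)) c`, `ξ = L^{−(k+1)}`, `π = sl2Proj`. [cite: Balaban1987RG1, (1.8) p.261, (4.35) p.290; Balaban1985Variational, (182) p.307] -/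
theorem fderiv_iota_inr_eq_of_shape
    (hι : ∀ e i, ι e i = Sum.elim (fun a => sl2Coord (MatrixLog.mlog ((bg e ((chartEquivJ F K).symm i).1 : SU 2) : MatA 2)) a)
      (fun a => sl2Coord (current sl2Proj ((F.P K).eta (k + 1)) (fun b => ιSU 2 (bg e b)) ((chartEquivJ F K).symm i).1) a) ((chartEquivJ F K).symm i).2)
    (h0 : bg 0 = 1) (U' : E →L[ℝ] (PBond (F.P K) 0 → MatA 2))
    (hU : HasFDerivAt (fun e => fun b : PBond (F.P K) 0 => ((bg e b : SU 2) : MatA 2)) U' 0) (hE : DifferentiableAt ℝ ι 0)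
    (δ : E) (b : PBond (F.P K) 0) (c : Fin 3) :
    fderiv ℝ ι 0 δ (chartEquivJ F K (b, Sum.inr c)) =
      sl2Coord (((((F.P K).eta (k + 1) : ℂ)⁻¹) ^ 3) • ((-I) • sl2Proj (∑ ν : Fin (F.P K).d,
        ((U' δ ⟨b.src, b.dir⟩ + U' δ ⟨b.src.shift b.dir, ν⟩ - U' δ ⟨b.src.shift ν, b.dir⟩ - U' δ ⟨b.src, ν⟩) -
          (U' δ ⟨b.src.unshift ν, b.dir⟩ + U' δ ⟨(b.src.unshift ν).shift b.dir, ν⟩ - U' δ ⟨(b.src.unshift ν).shift ν, b.dir⟩ - U' δ ⟨b.src.unshift ν, ν⟩))))) c := by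
  -- the line `t ↦ t • δ`
  have hℓ : HasDerivAt (fun t : ℝ => t • δ) δ 0 := ((hasDerivAt_id (0 : ℝ)).smul_const δ).congr_deriv (one_smul ℝ δ)
  have hℓ0 : (fun t : ℝ => t • δ) 0 = 0 := zero_smul ℝ δ
  have hEℓ : HasDerivAt (fun t : ℝ => ι (t • δ)) (fderiv ℝ ι 0 δ) 0 := hE.hasFDerivAt.comp_hasDerivAt_of_eq 0 hℓ hℓ0.symm
  have hEi : HasDerivAt (fun t : ℝ => ι (t • δ) (chartEquivJ F K (b, Sum.inr c))) (fderiv ℝ ι 0 δ (chartEquivJ F K (b, Sum.inr c))) 0 :=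
    (hasDerivAt_pi.1 hEℓ) _
  have hUℓ : HasDerivAt (fun t : ℝ => fun b' : PBond (F.P K) 0 => ((bg (t • δ) b' : SU 2) : MatA 2)) (U' δ) 0 := hU.comp_hasDerivAt_of_eq 0 hℓ hℓ0.symm
  have hW : ∀ b' : PBond (F.P K) 0, HasDerivAt (fun t : ℝ => ((ιSU 2 (bg (t • δ) b') : (MatA 2)ˣ) : MatA 2)) (U' δ b') 0 :=
    fun b' => (hasDerivAt_pi.1 hUℓ) b'
  have h1 : ∀ b' : PBond (F.P K) 0, ιSU 2 (bg ((0 : ℝ) • δ) b') = 1 := by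
    intro b'; rw [zero_smul, h0]; exact map_one _
  have hJ := hasDerivAt_current_one (W := fun t : ℝ => fun b' => ιSU 2 (bg (t • δ) b')) h1 hW sl2Proj ((F.P K).eta (k + 1)) b
  rw [current_lin_eq] at hJ
  obtain ⟨Lc, hLc, hc⟩ := hasFDerivAt_sl2Coord c (current sl2Proj ((F.P K).eta (k + 1)) (fun b' => ιSU 2 (bg ((0 : ℝ) • δ) b')) b)
  have hcomp := hc.comp_hasDerivAt_of_eq 0 hJ rfl
  have hfun : (fun t : ℝ => ι (t • δ) (chartEquivJ F K (b, Sum.inr c))) =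
      (fun A : MatA 2 => sl2Coord A c) ∘ fun t : ℝ => current sl2Proj ((F.P K).eta (k + 1)) (fun b' => ιSU 2 (bg (t • δ) b')) b := by
    funext t; simp only [Function.comp_apply, hι, Equiv.symm_apply_apply, Sum.elim_inr]
  rw [hfun] at hEi
  rw [hEi.unique hcomp, hLc]

/-! ## §4  The chart matrices of the CUT response -/

open scoped Classical in
/-- ★★ **`𝐔`-BLOCK CHART MATRIX OF THE CUT RESPONSE (any chart of the SHAPE)**: on `b ∈ X` it is `U′δ b` (traceless: `det ≡ 1`), off `X` it is `0`.
[cite: Balaban1987RG1, (4.4) p.281, (4.35) p.290; Balaban1985Variational, (182) p.307] -/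
theorem chartMatU_cutTo_fderiv_iota
    (hι : ∀ e i, ι e i = Sum.elim (fun a => sl2Coord (MatrixLog.mlog ((bg e ((chartEquivJ F K).symm i).1 : SU 2) : MatA 2)) a)
      (fun a => sl2Coord (current sl2Proj ((F.P K).eta (k + 1)) (fun b => ιSU 2 (bg e b)) ((chartEquivJ F K).symm i).1) a) ((chartEquivJ F K).symm i).2)
    (h0 : bg 0 = 1) (U' : E →L[ℝ] (PBond (F.P K) 0 → MatA 2))
    (hU : HasFDerivAt (fun e => fun b : PBond (F.P K) 0 => ((bg e b : SU 2) : MatA 2)) U' 0) (hE : DifferentiableAt ℝ ι 0)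
    (δ : E) {Mc : ℕ} (X : (recordDomSys F Mc k K).Dom) (b : PBond (F.P K) 0) :
    chartMatU F K (B12FormatPlus.cutTo (recordCXJ F Mc k K X) (fderiv ℝ ι 0 δ)) b = if b ∈ domBonds F Mc k K X then U' δ b else 0 := by
  classical
  have hmem : ∀ c : Fin 3, chartEquivJ F K (b, Sum.inl c) ∈ recordCXJ F Mc k K X ↔ b ∈ domBonds F Mc k K X := fun c => by simp [recordCXJ]
  by_cases hb : b ∈ domBonds F Mc k K X
  · rw [if_pos hb]
    have htr : (U' δ b).trace = 0 := by
      have hUb : HasFDerivAt (fun e => ((bg e b : SU 2) : MatA 2)) ((ContinuousLinearMap.proj b).comp U') 0 := (hasFDerivAt_pi'.1 hU) b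
      have hb1 : bg 0 b = 1 := by rw [h0]; rfl
      exact trace_eq_zero_of_hasFDerivAt_su hUb hb1 _
    rw [← sum_sl2Coord_smul_sl2Gen_of_trace_eq_zero htr]
    unfold chartMatU
    refine Finset.sum_congr rfl fun c _ => ?_
    rw [B12FormatPlus.cutTo_apply, if_pos ((hmem c).2 hb), fderiv_iota_inl_eq_of_shape F k K bg ι hι h0 U' hU hE δ b c]
  · rw [if_neg hb]
    unfold chartMatU
    refine Finset.sum_eq_zero fun c _ => ?_
    rw [B12FormatPlus.cutTo_apply, if_neg (mt (hmem c).1 hb), zero_smul]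

open scoped Classical in
/-- ★★ **`𝐉`-BLOCK CHART MATRIX OF THE CUT RESPONSE (any chart of the SHAPE)**: on `b ∈ X` it is the linearised current `−iξ⁻³π(d*d(U′δ))(b)`, off `X` it is `0`.
[cite: Balaban1987RG1, (1.8) p.261, (4.4) p.281, (4.35) p.290] -/
theorem chartMatJc_cutTo_fderiv_iota
    (hι : ∀ e i, ι e i = Sum.elim (fun a => sl2Coord (MatrixLog.mlog ((bg e ((chartEquivJ F K).symm i).1 : SU 2) : MatA 2)) a)
      (fun a => sl2Coord (current sl2Proj ((F.P K).eta (k + 1)) (fun b => ιSU 2 (bg e b)) ((chartEquivJ F K).symm i).1) a) ((chartEquivJ F K).symm i).2)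
    (h0 : bg 0 = 1) (U' : E →L[ℝ] (PBond (F.P K) 0 → MatA 2))
    (hU : HasFDerivAt (fun e => fun b : PBond (F.P K) 0 => ((bg e b : SU 2) : MatA 2)) U' 0) (hE : DifferentiableAt ℝ ι 0)
    (δ : E) {Mc : ℕ} (X : (recordDomSys F Mc k K).Dom) (b : PBond (F.P K) 0) :
    chartMatJc F K (B12FormatPlus.cutTo (recordCXJ F Mc k K X) (fderiv ℝ ι 0 δ)) b =
      if b ∈ domBonds F Mc k K X then
        ((((F.P K).eta (k + 1) : ℂ)⁻¹) ^ 3) • ((-I) • sl2Proj (∑ ν : Fin (F.P K).d,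
          ((U' δ ⟨b.src, b.dir⟩ + U' δ ⟨b.src.shift b.dir, ν⟩ - U' δ ⟨b.src.shift ν, b.dir⟩ - U' δ ⟨b.src, ν⟩) -
            (U' δ ⟨b.src.unshift ν, b.dir⟩ + U' δ ⟨(b.src.unshift ν).shift b.dir, ν⟩ - U' δ ⟨(b.src.unshift ν).shift ν, b.dir⟩ - U' δ ⟨b.src.unshift ν, ν⟩))))
      else 0 := by
  classical
  have hmem : ∀ c : Fin 3, chartEquivJ F K (b, Sum.inr c) ∈ recordCXJ F Mc k K X ↔ b ∈ domBonds F Mc k K X := fun c => by simp [recordCXJ]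
  by_cases hb : b ∈ domBonds F Mc k K X
  · rw [if_pos hb]
    have htr : ∀ (z w : ℂ) (M : MatA 2), (z • (w • sl2Proj M)).trace = 0 := by
      intro z w M; rw [Matrix.trace_smul, Matrix.trace_smul, trace_sl2Proj, smul_zero, smul_zero]
    rw [← sum_sl2Coord_smul_sl2Gen_of_trace_eq_zero (htr _ _ _)]
    unfold chartMatJc
    refine Finset.sum_congr rfl fun c _ => ?_
    rw [B12FormatPlus.cutTo_apply, if_pos ((hmem c).2 hb), fderiv_iota_inr_eq_of_shape F k K bg ι hι h0 U' hU hE δ b c]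
  · rw [if_neg hb]
    unfold chartMatJc
    refine Finset.sum_eq_zero fun c _ => ?_
    rw [B12FormatPlus.cutTo_apply, if_neg (mt (hmem c).1 hb), zero_smul]

/-! ## §4b  ENTRY currency: the derivative of the matrix-valued map from the entrywise one -/

/-- `Matrix.of`-bridge for derivatives (generic parameter space): if the ENTRY map is differentiable at `0`, the matrix-valued map has a derivative `U′` with `U′δ b = Matrix.of (D δ b)`.
[folklore] -/
theorem hasFDerivAt_matrix_of_entries {ι' : Type*} [Fintype ι'] {f : E → ι' → MatA 2}
    (hd : DifferentiableAt ℝ (fun e => fun (b : ι') (i i' : Fin 2) => f e b i i') 0) :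
    ∃ U' : E →L[ℝ] (ι' → MatA 2), (∀ δ b, U' δ b = Matrix.of (fderiv ℝ (fun e => fun (b : ι') (i i' : Fin 2) => f e b i i') 0 δ b)) ∧
      HasFDerivAt f U' 0 := by
  obtain ⟨e, he⟩ := exists_ofPiCLM ι'
  refine ⟨e.comp (fderiv ℝ (fun e => fun (b : ι') (i i' : Fin 2) => f e b i i') 0), fun δ b => by rw [ContinuousLinearMap.comp_apply, he], ?_⟩
  refine (e.hasFDerivAt.comp 0 hd.hasFDerivAt).congr_of_eventuallyEq (Filter.Eventually.of_forall fun x => ?_)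
  funext b
  rw [Function.comp_apply, he]
  ext i i'
  rfl

/-- ★★ **ENTRY form of the `𝐔`-block**: with `D := fderiv` of the entry map at `0` in the direction `δ`, on `b ∈ X` the `𝐔`-block chart matrix of the cut response is
`Matrix.of (D b)` (entry map `C¹` at `0`, `bg 0 = 1`, `ι` differentiable at `0`). [cite: Balaban1987RG1, (4.4) p.281, (4.35) p.290] -/
theorem chartMatU_cutTo_fderiv_iota_entries
    (hι : ∀ e i, ι e i = Sum.elim (fun a => sl2Coord (MatrixLog.mlog ((bg e ((chartEquivJ F K).symm i).1 : SU 2) : MatA 2)) a)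
      (fun a => sl2Coord (current sl2Proj ((F.P K).eta (k + 1)) (fun b => ιSU 2 (bg e b)) ((chartEquivJ F K).symm i).1) a) ((chartEquivJ F K).symm i).2)
    (h0 : bg 0 = 1) (hd : DifferentiableAt ℝ (fun e => fun (b : PBond (F.P K) 0) (i i' : Fin 2) => ((bg e b : SU 2) : MatA 2) i i') 0)
    (hE : DifferentiableAt ℝ ι 0) (δ : E) {Mc : ℕ} (X : (recordDomSys F Mc k K).Dom) (b : PBond (F.P K) 0) (hb : b ∈ domBonds F Mc k K X) :
    chartMatU F K (B12FormatPlus.cutTo (recordCXJ F Mc k K X) (fderiv ℝ ι 0 δ)) b =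
      Matrix.of (fderiv ℝ (fun e => fun (b : PBond (F.P K) 0) (i i' : Fin 2) => ((bg e b : SU 2) : MatA 2) i i') 0 δ b) := by
  obtain ⟨U', hU'eq, hU'⟩ := hasFDerivAt_matrix_of_entries (f := fun e => fun b : PBond (F.P K) 0 => ((bg e b : SU 2) : MatA 2)) hd
  have h := chartMatU_cutTo_fderiv_iota F k K bg ι hι h0 U' hU' hE δ X b
  rw [if_pos hb, hU'eq] at h
  exact h

/-! ## §5  The `𝐉`-clause from (190)'s fourth line, read on `D` itself (⁷‴ token shape) -/

/-- ★★ **THE `𝐉`-BLOCK OF THE CUT RESPONSE BOUNDED BY THE FOURTH (190)-CLAUSE ON `D`** (any chart of the SHAPE; entry map `C¹` at `0`, `bg 0 = 1`, `ι` differentiable):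
if `‖Σ_ν [(dD)(p_{μν}(x)) − (dD)(p_{μν}(x − e_ν))]‖ ≤ t` (sup-entry norm) at `b = (x, μ) ∈ X`, then `‖chartMatJc (cutTo (recordCXJ X) (Dι(0)δ)) b‖ ≤ 2·‖π_ℝ‖·ξ⁻³·t`.
[cite: Balaban1987RG1, (1.8) p.261, (4.4) p.281; Balaban1985Variational, (190) p.308 (fourth line)] -/
theorem norm_chartMatJc_cutTo_fderiv_iota_le
    (hι : ∀ e i, ι e i = Sum.elim (fun a => sl2Coord (MatrixLog.mlog ((bg e ((chartEquivJ F K).symm i).1 : SU 2) : MatA 2)) a)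
      (fun a => sl2Coord (current sl2Proj ((F.P K).eta (k + 1)) (fun b => ιSU 2 (bg e b)) ((chartEquivJ F K).symm i).1) a) ((chartEquivJ F K).symm i).2)
    (h0 : bg 0 = 1) (hd : DifferentiableAt ℝ (fun e => fun (b : PBond (F.P K) 0) (i i' : Fin 2) => ((bg e b : SU 2) : MatA 2) i i') 0)
    (hE : DifferentiableAt ℝ ι 0) (δ : E) {Mc : ℕ} (X : (recordDomSys F Mc k K).Dom) (b : PBond (F.P K) 0) (hb : b ∈ domBonds F Mc k K X) {t : ℝ}
    (h4 : letI D := fderiv ℝ (fun e => fun (b : PBond (F.P K) 0) (i i' : Fin 2) => ((bg e b : SU 2) : MatA 2) i i') 0 δ;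
      ‖∑ ν : Fin (F.P K).d, ((D ⟨b.src, b.dir⟩ + D ⟨(b.src).shift b.dir, ν⟩ - D ⟨(b.src).shift ν, b.dir⟩ - D ⟨b.src, ν⟩) -
        (D ⟨b.src.unshift ν, b.dir⟩ + D ⟨(b.src.unshift ν).shift b.dir, ν⟩ - D ⟨(b.src.unshift ν).shift ν, b.dir⟩ - D ⟨b.src.unshift ν, ν⟩))‖ ≤ t) :
    ‖chartMatJc F K (B12FormatPlus.cutTo (recordCXJ F Mc k K X) (fderiv ℝ ι 0 δ)) b‖ ≤
      2 * ‖LinearMap.toContinuousLinearMap (sl2Proj.restrictScalars ℝ)‖ * (((F.P K).eta (k + 1))⁻¹) ^ 3 * t := by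
  obtain ⟨U', hU'eq, hU'⟩ := hasFDerivAt_matrix_of_entries (f := fun e => fun b : PBond (F.P K) 0 => ((bg e b : SU 2) : MatA 2)) hd
  have h := chartMatJc_cutTo_fderiv_iota F k K bg ι hι h0 U' hU' hE δ X b
  rw [if_pos hb] at h
  rw [h]
  obtain ⟨e, he⟩ := exists_ofCLM
  set D : PBond (F.P K) 0 → Fin 2 → Fin 2 → ℂ := fderiv ℝ (fun e => fun (b : PBond (F.P K) 0) (i i' : Fin 2) => ((bg e b : SU 2) : MatA 2) i i') 0 δ with hDdef
  have hUe : ∀ b', U' δ b' = e (D b') := fun b' => by rw [hU'eq, he]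
  have hcurl : ∀ (x : Site (F.P K) 0) (μ ν : Fin (F.P K).d),
      U' δ ⟨x, μ⟩ + U' δ ⟨x.shift μ, ν⟩ - U' δ ⟨x.shift ν, μ⟩ - U' δ ⟨x, ν⟩ = e (D ⟨x, μ⟩ + D ⟨x.shift μ, ν⟩ - D ⟨x.shift ν, μ⟩ - D ⟨x, ν⟩) := by
    intro x μ ν
    rw [hUe, hUe, hUe, hUe, ← map_add, ← map_sub, ← map_sub]
  simp_rw [hcurl, ← map_sub, ← map_sum]
  have hξ : 0 < (F.P K).eta (k + 1) := by
    unfold Params.eta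
    exact pow_pos (inv_pos.2 (F.P K).cast_L_pos) _
  refine (norm_current_lin_le sl2Proj hξ _).trans ?_
  rw [he]
  have h2 := (norm_of_le_two_mul_norm _).trans (mul_le_mul_of_nonneg_left h4 zero_le_two)
  have hπ0 : 0 ≤ (((F.P K).eta (k + 1))⁻¹) ^ 3 * ‖LinearMap.toContinuousLinearMap (sl2Proj.restrictScalars ℝ)‖ := by positivity
  calc (((F.P K).eta (k + 1))⁻¹) ^ 3 * ‖LinearMap.toContinuousLinearMap (sl2Proj.restrictScalars ℝ)‖ * ‖(Matrix.of _ : MatA 2)‖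
      ≤ (((F.P K).eta (k + 1))⁻¹) ^ 3 * ‖LinearMap.toContinuousLinearMap (sl2Proj.restrictScalars ℝ)‖ * (2 * t) := mul_le_mul_of_nonneg_left h2 hπ0
    _ = 2 * ‖LinearMap.toContinuousLinearMap (sl2Proj.restrictScalars ℝ)‖ * (((F.P K).eta (k + 1))⁻¹) ^ 3 * t := by ring

end Shape

/-! ## §6  The record's rooted chart IS a chart of the SHAPE (`rfl`), so g0's∕file 2's name-level lemmas are instances -/

/-- The rooted two-block chart `recordEmbJ` has the SHAPE over `bg := recordBgField` (definitional). [cite: Balaban1987RG1, (1.8)–(1.9) p.261 (bookkeeping)] -/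
theorem recordEmbJ_shape (F : T4Family) (θ : Stage13Params F 2) (k K : ℕ) :
    letI := θ.instVβ₁; letI := θ.instVβ₂;
    ∀ (B : Fin (F.P K).d → Site (F.P K) (k + 1) → θ.Vβ) (i : Fin (recordChartDimJ F K)),
      recordEmbJ F θ k K B i = Sum.elim (fun a => sl2Coord (MatrixLog.mlog ((recordBgField F θ k K B ((chartEquivJ F K).symm i).1 : SU 2) : MatA 2)) a)
        (fun a => sl2Coord (current sl2Proj ((F.P K).eta (k + 1)) (fun b => ιSU 2 (recordBgField F θ k K B b)) ((chartEquivJ F K).symm i).1) a)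
        ((chartEquivJ F K).symm i).2 :=
  fun _ _ => rfl

end Summit.QuantumFields.YangMills.Theorems.PortU8

end
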